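import Summits.QuantumFields.BalabanUV.Beta.FP.SliceProjectorKernel

/-!
# `BalabanUV.Beta.FP.SliceProjectorKernelLaplace` — road «FP» (binder row D1), organisation γ, row **GAMMA-3 (d)** part 4∕5: **RANGE AND SLICE OF
# `(1 − Π)_N`** — the fine Laplacian `δ₁d` of a COLUMN of `piC N` is block-constant in the column variable (`Δ(1−Π) = Q′ᵀ·B`: the range is
# `Δ⁻¹Q′ᵀ(coarse)`), of a ROW is block-constant in the row variable (`(1−Π)Δ = Bᵀ·Q′`), and the SLICE COROLLARY **`Σ'_y piC N x y·(δ₁dχ)(y) = 0`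
# for every finitely supported block-mean-free `χ`** (`Π_N Δχ = Δχ` on `ker Q′`: the saturation that RHOA-11 ∕ GAMMA-4 consume at model level)

HONEST FRAMING (cell contract, verbatim): «discharging `BetaPertH` makes Bałaban's UV stability UNCONDITIONAL — a real constructive-QFT
result; it is NOT the continuum limit and NOT the Clay problem.»  HONEST DEPENDENCY (verbatim): «continuum YM on T⁴ ⇐ BetaPertH ∧ nine
spine estimates (0/9 proved); BetaPertH ⇐ (D1) ∧ (D4) ∧ CAP+tail; G-an2-4 gates asym, D1 and NE2/3/4.»  THIS MODULE DISCHARGES NOTHING of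
D1 ∕ BetaPertH: [folklore] the Laplacian stencil on Bloch characters (`FibreSymbols.pw_add_unitVec` BY NAME, `Σ_κ(2 − e^{iq_κ} − e^{−iq_κ}) = Δ¹(q)`),
the pole cancellation `e_l·Δ¹(k_l) = Δ^ξ(k)∕N²`, the block readings of `Q′` (`SliceProjectorBloch`), linearity of `latticeKernel` under integrability,
summation by parts against a finitely supported test function, block regrouping; over `FP/SliceProjectorKernel` ✓.  [our object] data defs
`lapColSym`, `lapRowSym` (the coarse symbols of `Δ_x piC` ∕ `Δ_y piC`); no `def … : Prop`; nothing is cited; 0 sorry.  NOT HERE: B-jets; ℓ²-completeness.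
NOT summit progress; NOT hbook, NOT D1, NOT BetaPertH, NOT continuum, NOT Clay.

ABSOLUTE RULE (cell, verbatim): «No internally-minted statement may enter as a cited fact. Every hypothesis is either kernel-proved in this
package or a verbatim quotation of a PUBLISHED theorem with page reference. The manuscript(s) under audit are NOT citable for their own
disputed steps — they are the thing under adjudication; programme-internal (2001/route/tribunal) claims are never citable.»

CONTENT (`D = d+1`, `N ≥ 1`, `δ₁d = AffineAveraging.codiff₁ ∘ dz` = the positive fine Laplacian):
* §7 `codiff₁_dz_apply`, `sum_two_sub_cexp`, `cphase_add_unitVec`∕`cphase_sub_unitVec`, **`ew_mul_Delta1_aliasPt`**, [our object] `lapColSym`, `lapRowSym`,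
  **`stencil_S_col`**∕**`stencil_S_row`** (the stencil at the symbol level lands on `cphase (blk x)` ∕ `cphase (−blk y)`), `latticeKernel_stencil`,
  **`laplace_piC_col`** (`(δ₁d)_x piC N x y = N^{−D}·latticeKernel (lapColSym N (−y)) (blk x)`), **`laplace_piC_row`**, `laplace_piC_col_blockConst`,
  `laplace_piC_row_blockConst`.
* §8 `sum_finSite_eq_blockSum` (bridge to `AffineAveraging.blockSum`), `tsum_mul_shift`, `summable_mul_of_support_finite`, **`tsum_mul_codiff₁_dz`**
  (summation by parts), **`tsum_piC_mul_laplace_eq_zero`** (THE SLICE COROLLARY).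
Unit `b2b-balaban-beta-d1-formalise-leaf-06` (gen 9), road «FP» OWNER GO «THIS SHAPE» journal l.27277 (1) on INTENT l.27194; organisation γ (R-FP-25), row GAMMA-3 (d), under R-FP-33 (b)(c).
-/

noncomputable section

namespace Summit.QuantumFields.BalabanUV.Beta.FP.SliceProjectorKernelLaplace

open Complex Finset MeasureTheory
open scoped BigOperators Real
open Literature.MathematicalPhysics.QuantumFieldTheory.Balaban1983to89
open Literature.MathematicalPhysics.QuantumFieldTheory.Balaban1983to89.Beta.AffineAveraging (Site box toSite blockSum unitVec dz codiff₁)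
open B4Strip (Strip ofRealVec DeltaXi Delta1 S1 shift U)
open B4StripCauchy (Fat rOf rOf_le)
open B5Strip145 (Ncal)
open B4ContourShift (BZ phase integrand fourierBox latticeKernel StripRegular supNorm)
open B4Green244 (latticeKernel_congr)
open Beta.FibreInverseDecay (cphase)
open Summit.QuantumFields.BalabanUV.Beta.GAN24.AliasDecimate (aliasPt)
open Summit.QuantumFields.BalabanUV.Beta.FP.SliceProjectorMidInv (kapY kapY_pos)
open Summit.QuantumFields.BalabanUV.Beta.FP.SliceProjectorEntries (qa qb ew Aent)
open Summit.QuantumFields.BalabanUV.Beta.FP.SliceProjectorSymbol (S DeltaXi_shift_eq)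
open Summit.QuantumFields.BalabanUV.Beta.FP.SliceProjectorAliasSum (stripRegular_S)
open Summit.QuantumFields.BalabanUV.Beta.FP.SliceProjectorBlochChart
open Summit.QuantumFields.BalabanUV.Beta.FP.SliceProjectorBloch
open Summit.QuantumFields.BalabanUV.Beta.FP.SliceProjectorKernel

variable {d : ℕ}

/-! ## §7 RANGE ∕ SLICE: the fine Laplacian of a row (resp. column) of `(1−Π)_N` is BLOCK-CONSTANT — `Δ(1−Π) = Q′ᵀ·(coarse×fine kernel)`,
`(1−Π)Δ = (fine×coarse kernel)·Q′` (so `Π Δχ = Δχ` whenever `Q′χ = 0`: saturation ∕ (W)-input of RHOA-11 ∕ GAMMA-4 at the road instance) -/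

section Laplace

variable (N : ℕ) [NeZero N]

/-- [folklore] the fine (positive) Laplacian `δ₁d` of `AffineAveraging` evaluated: `(δ₁ d f)(x) = Σ_κ (2f(x) − f(x+e_κ) − f(x−e_κ))`. -/
theorem codiff₁_dz_apply (f : (Fin (d + 1) → ℤ) → ℂ) (x : Fin (d + 1) → ℤ) :
    codiff₁ (dz f) x = ∑ κ, (2 * f x - f (x + unitVec κ) - f (x - unitVec κ)) := by
  simp only [codiff₁, dz, sub_add_cancel]
  exact Finset.sum_congr rfl fun κ _ => by ring

/-- [folklore] the Laplacian symbol on a character: `Σ_κ (2 − e^{i q_κ} − e^{−i q_κ}) = Δ¹(q)`. -/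
theorem sum_two_sub_cexp (q : Fin (d + 1) → ℂ) : ∑ κ, (2 - cexp (I * q κ) - cexp (-(I * q κ))) = Delta1 0 q := by
  unfold Delta1 S1
  rw [Complex.ofReal_zero, add_zero]
  exact Finset.sum_congr rfl fun κ _ => by rw [Complex.two_cos]; ring_nf

/-- [folklore] `cphase (x + e_κ) q = e^{i q_κ}·cphase x q` (`FibreSymbols.pw_add_unitVec`). -/
theorem cphase_add_unitVec (x : Fin (d + 1) → ℤ) (κ : Fin (d + 1)) (q : Fin (d + 1) → ℂ) :
    cphase (x + unitVec κ) q = cexp (I * q κ) * cphase x q :=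
  Summit.QuantumFields.BalabanUV.Beta.GAN24.FibreSymbols.pw_add_unitVec q x κ

/-- [folklore] `cphase (x − e_κ) q = e^{−i q_κ}·cphase x q` (`FibreSymbols.pw_sub_unitVec`). -/
theorem cphase_sub_unitVec (x : Fin (d + 1) → ℤ) (κ : Fin (d + 1)) (q : Fin (d + 1) → ℂ) :
    cphase (x - unitVec κ) q = cexp (-(I * q κ)) * cphase x q :=
  Summit.QuantumFields.BalabanUV.Beta.GAN24.FibreSymbols.pw_sub_unitVec q x κ

/-- [folklore] **THE POLE CANCELS (unit-lattice form)**: `e_l(k)·Δ¹(k_l) = Δ^ξ(k)∕N²` on the fat strip. -/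
theorem ew_mul_Delta1_aliasPt {k : Fin (d + 1) → ℂ} (hk : k ∈ Fat (d + 1) (rOf (d + 1))) (l : Fin (d + 1) → Fin N) :
    ew N l k * Delta1 0 (aliasPt N l k) = DeltaXi N 0 k / (N : ℂ) ^ 2 := by
  have hN : ((N : ℂ) ^ 2) ≠ 0 := pow_ne_zero _ (Nat.cast_ne_zero.mpr (NeZero.ne N))
  have h := ew_mul_DeltaXi_shift N hk l
  rw [DeltaXi_shift_eq] at h
  rw [eq_div_iff hN, ← h]; ring

/-- [our object] the COLUMN-LAPLACIAN coarse symbol `lapColSym N b′ k := Ra N b′ k · Δ^ξ(k) ∕ (N²·𝒩(k))`. -/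
def lapColSym (b' : Fin (d + 1) → ℤ) (k : Fin (d + 1) → ℂ) : ℂ := Ra N b' k * DeltaXi N 0 k / ((N : ℂ) ^ 2 * Ncal N k)

/-- [our object] the ROW-LAPLACIAN coarse symbol `lapRowSym N b k := Rb N b k · Δ^ξ(k) ∕ (N²·𝒩(k))`. -/
def lapRowSym (b : Fin (d + 1) → ℤ) (k : Fin (d + 1) → ℂ) : ℂ := Rb N b k * DeltaXi N 0 k / ((N : ℂ) ^ 2 * Ncal N k)

/-- [folklore] **THE FINE LAPLACIAN STENCIL IN THE COLUMN VARIABLE, AT THE SYMBOL LEVEL**: on the fat strip,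
`Σ_κ (2·S(b′,−x) − S(b′,−(x+e_κ)) − S(b′,−(x−e_κ))) = lapColSym N b′ k · cphase (blk x) k` — the fine point `x` survives only through its block. -/
theorem stencil_S_col {k : Fin (d + 1) → ℂ} (hk : k ∈ Fat (d + 1) (rOf (d + 1))) (b' x : Fin (d + 1) → ℤ) :
    ∑ κ, (2 * S N b' (-x) k - S N b' (-(x + unitVec κ)) k - S N b' (-(x - unitVec κ)) k) = lapColSym N b' k * cphase (blkN N x) k := by
  have hstep : ∀ κ : Fin (d + 1), 2 * S N b' (-x) k - S N b' (-(x + unitVec κ)) k - S N b' (-(x - unitVec κ)) k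
      = ∑ l : Fin (d + 1) → Fin N, ∑ l' : Fin (d + 1) → Fin N,
          cphase b' (aliasPt N l k) * Aent N l l' k * cphase x (aliasPt N l' k)
            * (2 - cexp (I * aliasPt N l' k κ) - cexp (-(I * aliasPt N l' k κ))) := by
    intro κ
    unfold S
    simp_rw [neg_neg, cphase_add_unitVec, cphase_sub_unitVec, Finset.mul_sum, ← Finset.sum_sub_distrib]
    exact Finset.sum_congr rfl fun l _ => Finset.sum_congr rfl fun l' _ => by ring
  simp_rw [hstep]
  rw [Finset.sum_comm]
  simp_rw [Finset.sum_comm (γ := Fin (d + 1)), ← Finset.mul_sum, sum_two_sub_cexp]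
  -- now `Σ_l Σ_l' cphase b' · A · cphase x · Δ¹(k_l')`
  have hA : ∀ l l' : Fin (d + 1) → Fin N, Aent N l l' k * Delta1 0 (aliasPt N l' k)
      = (qa N l k * ew N l k) * qb N l' k * (DeltaXi N 0 k / ((N : ℂ) ^ 2 * Ncal N k)) := by
    intro l l'
    unfold Aent
    rw [show qa N l k * ew N l k * (qb N l' k * ew N l' k) / Ncal N k * Delta1 0 (aliasPt N l' k)
        = qa N l k * ew N l k * qb N l' k * (ew N l' k * Delta1 0 (aliasPt N l' k)) / Ncal N k by ring, ew_mul_Delta1_aliasPt N hk l']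
    by_cases hN : Ncal N k = 0
    · simp [hN]
    · field_simp
  calc ∑ l : Fin (d + 1) → Fin N, ∑ l' : Fin (d + 1) → Fin N,
        cphase b' (aliasPt N l k) * Aent N l l' k * cphase x (aliasPt N l' k) * Delta1 0 (aliasPt N l' k)
      = (∑ l : Fin (d + 1) → Fin N, cphase b' (aliasPt N l k) * (qa N l k * ew N l k))
          * (DeltaXi N 0 k / ((N : ℂ) ^ 2 * Ncal N k)) * ∑ l' : Fin (d + 1) → Fin N, qb N l' k * cphase x (aliasPt N l' k) := by
        rw [Finset.sum_mul, Finset.sum_mul]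
        refine Finset.sum_congr rfl fun l _ => ?_
        rw [Finset.mul_sum]
        refine Finset.sum_congr rfl fun l' _ => ?_
        rw [mul_assoc (cphase b' (aliasPt N l k)) (Aent N l l' k), mul_assoc (cphase b' (aliasPt N l k)), mul_assoc (Aent N l l' k),
          mul_comm (cphase x (aliasPt N l' k)) (Delta1 0 _), ← mul_assoc (Aent N l l' k), hA]
        ring
    _ = lapColSym N b' k * cphase (blkN N x) k := by rw [sum_qb_mul_cphase]; unfold lapColSym Ra; ring

/-- [folklore] **THE FINE LAPLACIAN STENCIL IN THE ROW VARIABLE, AT THE SYMBOL LEVEL**: on the fat strip,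
`Σ_κ (2·S(−y,b) − S(−(y+e_κ),b) − S(−(y−e_κ),b)) = lapRowSym N b k · cphase (−blk y) k`. -/
theorem stencil_S_row {k : Fin (d + 1) → ℂ} (hk : k ∈ Fat (d + 1) (rOf (d + 1))) (y b : Fin (d + 1) → ℤ) :
    ∑ κ, (2 * S N (-y) b k - S N (-(y + unitVec κ)) b k - S N (-(y - unitVec κ)) b k) = lapRowSym N b k * cphase (-(blkN N y)) k := by
  have hstep : ∀ κ : Fin (d + 1), 2 * S N (-y) b k - S N (-(y + unitVec κ)) b k - S N (-(y - unitVec κ)) b k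
      = ∑ l : Fin (d + 1) → Fin N, ∑ l' : Fin (d + 1) → Fin N,
          cphase (-y) (aliasPt N l k) * Aent N l l' k * cphase (-b) (aliasPt N l' k)
            * (2 - cexp (I * aliasPt N l k κ) - cexp (-(I * aliasPt N l k κ))) := by
    intro κ
    unfold S
    simp_rw [neg_add, ← sub_eq_add_neg, neg_sub', sub_neg_eq_add, cphase_add_unitVec, cphase_sub_unitVec, Finset.mul_sum,
      ← Finset.sum_sub_distrib]
    exact Finset.sum_congr rfl fun l _ => Finset.sum_congr rfl fun l' _ => by ring
  simp_rw [hstep]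
  rw [Finset.sum_comm]
  simp_rw [Finset.sum_comm (γ := Fin (d + 1)), ← Finset.mul_sum, sum_two_sub_cexp]
  have hA : ∀ l l' : Fin (d + 1) → Fin N, Delta1 0 (aliasPt N l k) * Aent N l l' k
      = qa N l k * (qb N l' k * ew N l' k) * (DeltaXi N 0 k / ((N : ℂ) ^ 2 * Ncal N k)) := by
    intro l l'
    unfold Aent
    rw [show Delta1 0 (aliasPt N l k) * (qa N l k * ew N l k * (qb N l' k * ew N l' k) / Ncal N k)
        = qa N l k * (qb N l' k * ew N l' k) * (ew N l k * Delta1 0 (aliasPt N l k)) / Ncal N k by ring, ew_mul_Delta1_aliasPt N hk l]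
    by_cases hN : Ncal N k = 0
    · simp [hN]
    · field_simp
  calc ∑ l : Fin (d + 1) → Fin N, ∑ l' : Fin (d + 1) → Fin N,
        cphase (-y) (aliasPt N l k) * Aent N l l' k * cphase (-b) (aliasPt N l' k) * Delta1 0 (aliasPt N l k)
      = (∑ l : Fin (d + 1) → Fin N, qa N l k * cphase (-y) (aliasPt N l k))
          * (DeltaXi N 0 k / ((N : ℂ) ^ 2 * Ncal N k)) * ∑ l' : Fin (d + 1) → Fin N, cphase (-b) (aliasPt N l' k) * (qb N l' k * ew N l' k) := by
        rw [Finset.sum_mul, Finset.sum_mul]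
        refine Finset.sum_congr rfl fun l _ => ?_
        rw [Finset.mul_sum]
        refine Finset.sum_congr rfl fun l' _ => ?_
        rw [mul_comm _ (Delta1 0 (aliasPt N l k)), ← mul_assoc, ← mul_assoc, mul_comm (Delta1 0 _) (cphase (-y) _), mul_assoc (cphase (-y) _),
          hA]
        ring
    _ = lapRowSym N b k * cphase (-(blkN N y)) k := by rw [sum_qa_mul_cphase_neg]; unfold lapRowSym Rb; ring

/-- [folklore] **THE LATTICE KERNEL COMMUTES WITH THE LAPLACIAN STENCIL** (linearity under integrability on the zone). -/
theorem latticeKernel_stencil {T : (Fin (d + 1) → ℤ) → (Fin (d + 1) → ℂ) → ℂ}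
    (hint : ∀ x', IntegrableOn (integrand (T x') 0) (BZ (d + 1))) (x : Fin (d + 1) → ℤ) :
    ∑ κ, (2 * latticeKernel (T x) 0 - latticeKernel (T (x + unitVec κ)) 0 - latticeKernel (T (x - unitVec κ)) 0)
      = latticeKernel (fun k => ∑ κ, (2 * T x k - T (x + unitVec κ) k - T (x - unitVec κ) k)) 0 := by
  unfold latticeKernel fourierBox
  set g : Fin (d + 1) → (Fin (d + 1) → ℝ) → ℂ :=
    fun κ p => (2 : ℂ) * integrand (T x) 0 p - integrand (T (x + unitVec κ)) 0 p - integrand (T (x - unitVec κ)) 0 p with hg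
  have hI : integrand (fun k => ∑ κ, (2 * T x k - T (x + unitVec κ) k - T (x - unitVec κ) k)) 0 = fun p => ∑ κ, g κ p := by
    funext p
    simp only [hg, integrand, Finset.sum_mul]
    exact Finset.sum_congr rfl fun κ _ => by ring
  have hgi : ∀ κ, Integrable (g κ) (volume.restrict (BZ (d + 1))) := fun κ => (((hint x).const_mul 2).sub (hint _)).sub (hint _)
  have h2 : ∀ κ, (2 * ((((2 * π) ^ (d + 1))⁻¹ : ℝ) • ∫ p in BZ (d + 1), integrand (T x) 0 p)
      - (((2 * π) ^ (d + 1))⁻¹ : ℝ) • ∫ p in BZ (d + 1), integrand (T (x + unitVec κ)) 0 p)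
      - (((2 * π) ^ (d + 1))⁻¹ : ℝ) • ∫ p in BZ (d + 1), integrand (T (x - unitVec κ)) 0 p
      = (((2 * π) ^ (d + 1))⁻¹ : ℝ) • ∫ p in BZ (d + 1), g κ p := by
    intro κ
    have i1 : Integrable (fun p => (2 : ℂ) * integrand (T x) 0 p) (volume.restrict (BZ (d + 1))) := (hint x).const_mul 2
    have i2 : Integrable (fun p => (2 : ℂ) * integrand (T x) 0 p - integrand (T (x + unitVec κ)) 0 p) (volume.restrict (BZ (d + 1))) :=
      i1.sub (hint _)
    have e1 : ∫ p in BZ (d + 1), g κ p = 2 * (∫ p in BZ (d + 1), integrand (T x) 0 p)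
        - (∫ p in BZ (d + 1), integrand (T (x + unitVec κ)) 0 p) - (∫ p in BZ (d + 1), integrand (T (x - unitVec κ)) 0 p) := by
      refine (integral_sub i2 (hint _)).trans ?_
      refine congrArg (fun t => t - ∫ p in BZ (d + 1), integrand (T (x - unitVec κ)) 0 p) ?_
      refine (integral_sub i1 (hint _)).trans ?_
      refine congrArg (fun t => t - ∫ p in BZ (d + 1), integrand (T (x + unitVec κ)) 0 p) ?_
      exact integral_const_mul _ _
    rw [e1, smul_sub, smul_sub, mul_smul_comm]
  rw [Finset.sum_congr rfl fun κ _ => h2 κ, ← Finset.smul_sum, hI, integral_finsetSum Finset.univ fun κ _ => hgi κ]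

/-- [our object] **`Δ_x (1−Π)_N(x, y)` IS BLOCK-CONSTANT IN `x`** (the range of `1 − Π` is `Δ⁻¹Q′ᵀ(coarse)`):
`(δ₁d)_x piC N x y = N^{−D} · latticeKernel (lapColSym N (−y)) (blk x)`. -/
theorem laplace_piC_col (x y : Fin (d + 1) → ℤ) :
    codiff₁ (dz fun x' => piC N x' y) x = (((N : ℂ) ^ (d + 1))⁻¹) * latticeKernel (lapColSym N (-y)) (blkN N x) := by
  have hκ := kapY_pos (d + 1)
  rw [codiff₁_dz_apply]
  unfold piC
  have hlin := latticeKernel_stencil (T := fun x' k => S N (-y) (-x') k) (fun x' => (stripRegular_S N (-y) (-x')).integrableOn hκ.le 0) x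
  have hcongr : latticeKernel (fun k => ∑ κ, (2 * S N (-y) (-x) k - S N (-y) (-(x + unitVec κ)) k - S N (-y) (-(x - unitVec κ)) k)) 0
      = latticeKernel (fun k => lapColSym N (-y) k * cphase (blkN N x) k) 0 :=
    latticeKernel_congr (fun p hp => stencil_S_col N (ofRealVec_mem_Fat hp) (-y) x) 0
  rw [← latticeKernel_mul_cphase_zero (lapColSym N (-y)) (blkN N x), ← hcongr, ← hlin, Finset.mul_sum]
  exact Finset.sum_congr rfl fun κ _ => by ring

/-- [our object] **`Δ_y (1−Π)_N(x, y)` IS BLOCK-CONSTANT IN `y`** (`(1−Π)Δ` kills `ker Q′`):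
`(δ₁d)_y piC N x y = N^{−D} · latticeKernel (lapRowSym N (−x)) (−blk y)`. -/
theorem laplace_piC_row (x y : Fin (d + 1) → ℤ) :
    codiff₁ (dz fun y' => piC N x y') y = (((N : ℂ) ^ (d + 1))⁻¹) * latticeKernel (lapRowSym N (-x)) (-(blkN N y)) := by
  have hκ := kapY_pos (d + 1)
  rw [codiff₁_dz_apply]
  unfold piC
  have hlin := latticeKernel_stencil (T := fun y' k => S N (-y') (-x) k) (fun y' => (stripRegular_S N (-y') (-x)).integrableOn hκ.le 0) y
  have hcongr : latticeKernel (fun k => ∑ κ, (2 * S N (-y) (-x) k - S N (-(y + unitVec κ)) (-x) k - S N (-(y - unitVec κ)) (-x) k)) 0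
      = latticeKernel (fun k => lapRowSym N (-x) k * cphase (-(blkN N y)) k) 0 :=
    latticeKernel_congr (fun p hp => stencil_S_row N (ofRealVec_mem_Fat hp) y (-x)) 0
  rw [← latticeKernel_mul_cphase_zero (lapRowSym N (-x)) (-(blkN N y)), ← hcongr, ← hlin, Finset.mul_sum]
  exact Finset.sum_congr rfl fun κ _ => by ring

/-- [our object] COROLLARY: `x ↦ (δ₁d)_x piC N x y` is constant on blocks. -/
theorem laplace_piC_col_blockConst {x x' : Fin (d + 1) → ℤ} (h : blkN N x = blkN N x') (y : Fin (d + 1) → ℤ) :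
    codiff₁ (dz fun x'' => piC N x'' y) x = codiff₁ (dz fun x'' => piC N x'' y) x' := by
  rw [laplace_piC_col, laplace_piC_col, h]

/-- [our object] COROLLARY: `y ↦ (δ₁d)_y piC N x y` is constant on blocks. -/
theorem laplace_piC_row_blockConst (x : Fin (d + 1) → ℤ) {y y' : Fin (d + 1) → ℤ} (h : blkN N y = blkN N y') :
    codiff₁ (dz fun y'' => piC N x y'') y = codiff₁ (dz fun y'' => piC N x y'') y' := by
  rw [laplace_piC_row, laplace_piC_row, h]

end Laplace

/-! ## §8 THE SLICE COROLLARY: `(1−Π)_N` kills `Δχ` for every finitely supported block-mean-free `χ` (`Π Δχ = Δχ` on `ker Q′`) -/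

section Slice

variable (N : ℕ) [NeZero N]

omit [NeZero N] in
/-- [folklore] the `Fin`-indexed block sum IS `AffineAveraging.blockSum`: `Σ_{c} f (N•Y + finSite c) = blockSum N f Y`. -/
theorem sum_finSite_eq_blockSum (f : (Fin (d + 1) → ℤ) → ℂ) (Y : Fin (d + 1) → ℤ) :
    ∑ c : Fin (d + 1) → Fin N, f ((N : ℤ) • Y + finSite N c) = blockSum N f Y := by
  classical
  unfold blockSum
  have hbox : box (d + 1) N = (Finset.univ : Finset (Fin (d + 1) → Fin N)).image (fun c μ => (c μ : ℕ)) := by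
    ext b
    simp only [Literature.MathematicalPhysics.QuantumFieldTheory.Balaban1983to89.Beta.AffineAveraging.box, Fintype.mem_piFinset,
      Finset.mem_range, Finset.mem_image, Finset.mem_univ, true_and]
    exact ⟨fun h => ⟨fun μ => ⟨b μ, h μ⟩, funext fun μ => rfl⟩, by rintro ⟨c, rfl⟩ μ; exact (c μ).isLt⟩
  rw [hbox, Finset.sum_image (fun c _ c' _ h => funext fun μ => Fin.ext (congrFun h μ))]
  rfl

/-- [folklore] a shift of the summation variable: `Σ'_y f y · χ (y + v) = Σ'_y f (y − v) · χ y`. -/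
theorem tsum_mul_shift (f χ : (Fin (d + 1) → ℤ) → ℂ) (v : Fin (d + 1) → ℤ) :
    ∑' y, f y * χ (y + v) = ∑' y, f (y - v) * χ y := by
  rw [← (Equiv.subRight v).tsum_eq (fun y => f y * χ (y + v))]
  exact tsum_congr fun y => by simp [Equiv.subRight]

/-- [folklore] finitely supported functions times anything are summable. -/
theorem summable_mul_of_support_finite {χ : (Fin (d + 1) → ℤ) → ℂ} (hχ : χ.support.Finite) (f : (Fin (d + 1) → ℤ) → ℂ)
    (v : Fin (d + 1) → ℤ) : Summable fun y => f y * χ (y + v) := by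
  refine summable_of_hasFiniteSupport (((hχ.preimage (Set.injOn_of_injective (add_left_injective v))).subset ?_))
  intro y hy
  simp only [Function.mem_support, ne_eq, mul_eq_zero, not_or] at hy
  exact hy.2

/-- [folklore] **SUMMATION BY PARTS FOR THE FINE LAPLACIAN** against a finitely supported `χ`:
`Σ'_y f y · (δ₁dχ)(y) = Σ'_y (δ₁d f)(y) · χ y`. -/
theorem tsum_mul_codiff₁_dz (f : (Fin (d + 1) → ℤ) → ℂ) {χ : (Fin (d + 1) → ℤ) → ℂ} (hχ : χ.support.Finite) :
    ∑' y, f y * codiff₁ (dz χ) y = ∑' y, codiff₁ (dz f) y * χ y := by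
  have h0 : ∀ y, f y * codiff₁ (dz χ) y = ∑ κ, (2 * (f y * χ (y + 0)) - f y * χ (y + unitVec κ) - f y * χ (y + -unitVec κ)) := by
    intro y
    rw [codiff₁_dz_apply, Finset.mul_sum]
    exact Finset.sum_congr rfl fun κ _ => by rw [add_zero, ← sub_eq_add_neg]; ring
  have h1 : ∀ y, codiff₁ (dz f) y * χ y = ∑ κ, (2 * (f (y - 0) * χ y) - f (y - unitVec κ) * χ y - f (y - -unitVec κ) * χ y) := by
    intro y
    rw [codiff₁_dz_apply, Finset.sum_mul]
    exact Finset.sum_congr rfl fun κ _ => by rw [sub_zero, sub_neg_eq_add]; ring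
  simp_rw [h0, h1]
  have hs := fun v => summable_mul_of_support_finite hχ f v
  rw [Summable.tsum_finsetSum (fun κ _ => (((hs 0).mul_left 2).sub (hs _)).sub (hs _)),
    Summable.tsum_finsetSum (fun κ _ => ?_)]
  · refine Finset.sum_congr rfl fun κ _ => ?_
    rw [Summable.tsum_sub (((hs 0).mul_left 2).sub (hs _)) (hs _), Summable.tsum_sub ((hs 0).mul_left 2) (hs _), tsum_mul_left,
      tsum_mul_shift, tsum_mul_shift, tsum_mul_shift]
    have hs' : ∀ v, Summable fun y => f (y - v) * χ y := by
      intro v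
      have h := (Equiv.subRight v).summable_iff.mpr (hs v)
      refine h.congr fun y => ?_
      simp [Equiv.subRight]
    rw [Summable.tsum_sub (((hs' 0).mul_left 2).sub (hs' _)) (hs' _), Summable.tsum_sub ((hs' 0).mul_left 2) (hs' _), tsum_mul_left]
  · have hs' : ∀ v, Summable fun y => f (y - v) * χ y := by
      intro v
      have h := (Equiv.subRight v).summable_iff.mpr (hs v)
      refine h.congr fun y => ?_
      simp [Equiv.subRight]
    exact (((hs' 0).mul_left 2).sub (hs' _)).sub (hs' _)

/-- [our object] **THE SLICE COROLLARY — `(1 − Π)_N · Δχ = 0` FOR BLOCK-MEAN-FREE `χ`**: for every finitely supported `χ : ℤ^D → ℂ` all of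
whose block sums vanish (`blockSum N χ = 0`, i.e. `Q′χ = 0`), `Σ'_y piC N x y · (δ₁dχ)(y) = 0` at every `x` — equivalently `Π_N (Δχ) = Δχ`,
the SATURATION of the slice `Δ(ker Q′)` by `Π` that RHOA-11 ∕ GAMMA-4 consume at model level. -/
theorem tsum_piC_mul_laplace_eq_zero (x : Fin (d + 1) → ℤ) {χ : (Fin (d + 1) → ℤ) → ℂ} (hχ : χ.support.Finite)
    (hQ : ∀ Y, blockSum N χ Y = 0) : ∑' y, piC N x y * codiff₁ (dz χ) y = 0 := by
  rw [tsum_mul_codiff₁_dz (fun y => piC N x y) hχ]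
  simp_rw [laplace_piC_row]
  have hsum : Summable fun y => (((N : ℂ) ^ (d + 1))⁻¹) * latticeKernel (lapRowSym N (-x)) (-(blkN N y)) * χ y := by
    have h := summable_mul_of_support_finite hχ (fun y => (((N : ℂ) ^ (d + 1))⁻¹) * latticeKernel (lapRowSym N (-x)) (-(blkN N y))) 0
    simpa using h
  rw [tsum_blocksN N hsum]
  simp_rw [blkN_chart, ← Finset.mul_sum, sum_finSite_eq_blockSum, hQ, mul_zero, tsum_zero]

end Slice

end Summit.QuantumFields.BalabanUV.Beta.FP.SliceProjectorKernelLaplace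

end
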